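import Mathlib.RingTheory.MvPolynomial.WeightedHomogeneous
import Mathlib.Algebra.MonoidAlgebra.MapDomain
import Mathlib.Data.ZMod.Basic
import HarnessLib

/-!
# The root-cover substitution of a weighted blow-up chart (crux `FInjectiveMacaulayfication`, line `Sketch`)

Support file for crux stmt-ResolutionOfSingularities-15315 (`FrobeniusLadder.FInjectiveMacaulayfication`,
line `Sketch`), stub `stub_weightedSubstitution` of the cycle-9 WEIGHTED CONE ENGINE (§15 of the
registered skeleton 10f06f91). Fix weights `w : Fin n → ℕ` and a chart index `v` with `0 < w v`. The
`k`-algebra endomorphism `θ = θ_v` of `k[X] = MvPolynomial (Fin n) k`,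
`θ (X v) = X v ^ (w v)`, `θ (X j) = X j * X v ^ (w j)` (`j ≠ v`), is the substitution realising the
`X v ^ c`-chart of the weighted blow-up as a quotient of a root cover. Grade `k[X]` by `ℤ/(w v)` with
`W v = 1`, `W j = -(w j)` (`j ≠ v`). The stub records the four facts the engine uses:

* `θ` is injective (it maps the monomial `X^a` to the monomial `X^(e a)` with
  `e a = a.erase v + single v (weight w a)`, and `e` is injective since `0 < w v`);
* every `θ U` is `W`-homogeneous of weight `0`;
* conversely a `W`-weight-`0` polynomial `U` becomes a value of `θ` after multiplication by a power
  `X v ^ (w v * M)` (monomialwise: `b v ≡ Σ_{j ≠ v} w j b j (mod w v)` is exactly weight `0`);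
* the component rule `(ψ u)_m = ψ · u_{m - δ}` for `ψ` homogeneous of weight `δ` (coefficientwise).

All proofs are elementary monomial bookkeeping. [folklore]
-/

-- single-problem summit: the doubled namespace component is forced
set_option linter.dupNamespace false

namespace Summit.ResolutionOfSingularities.ResolutionOfSingularities.Theorems.FInjectiveMacaulayfication.WeightedSubstitution

open MvPolynomial Finsupp

/-! ### The component rule -/

/-- **Component rule.** For a grading of `MvPolynomial σ R` by an additive group `M` through weights
`W`, if `ψ` is weighted homogeneous of degree `δ` then taking the degree-`m` component commutes with
multiplication by `ψ` up to the shift: `(ψ u)_m = ψ · u_{m - δ}`. Coefficientwise: in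
`coeff d (ψ u) = Σ_{a + b = d} ψ_a u_b` only pairs with `weight a = δ` contribute, and then
`weight b = m - δ ↔ weight d = m`. [folklore] -/
theorem weightedHomogeneousComponent_mul_of_isWeightedHomogeneous {σ R M : Type*} [CommSemiring R]
    [AddCommGroup M] {W : σ → M} {ψ : MvPolynomial σ R} {δ : M}
    (hψ : IsWeightedHomogeneous W ψ δ) (u : MvPolynomial σ R) (m : M) :
    weightedHomogeneousComponent W m (ψ * u) = ψ * weightedHomogeneousComponent W (m - δ) u := by
  classical
  ext d
  rw [coeff_weightedHomogeneousComponent, coeff_mul, coeff_mul]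
  split_ifs with hd
  · refine Finset.sum_congr rfl (fun x hx => ?_)
    rw [coeff_weightedHomogeneousComponent]
    by_cases hx1 : coeff x.1 ψ = 0
    · simp only [hx1, zero_mul]
    · have hx2 : weight W x.2 = m - δ := by
        rw [eq_sub_iff_add_eq', ← hψ hx1, ← map_add, Finset.HasAntidiagonal.mem_antidiagonal.mp hx,
          hd]
      rw [if_pos hx2]
  · symm
    refine Finset.sum_eq_zero (fun x hx => ?_)
    rw [coeff_weightedHomogeneousComponent]
    by_cases hx1 : coeff x.1 ψ = 0
    · simp only [hx1, zero_mul]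
    · rw [if_neg, mul_zero]
      intro hx2
      apply hd
      rw [← Finset.HasAntidiagonal.mem_antidiagonal.mp hx, map_add, hψ hx1, hx2, add_sub_cancel]

/-! ### The exponent map of `θ` -/

variable {k : Type} [Field k] {n : ℕ} (w : Fin n → ℕ) (v : Fin n)

/-- The exponent map `e a = a.erase v + single v (weight w a)` is additive. -/
theorem expMap_add (a b : Fin n →₀ ℕ) :
    (a + b).erase v + single v (weight w (a + b)) =
      (a.erase v + single v (weight w a)) + (b.erase v + single v (weight w b)) := by
  rw [erase_add, map_add, single_add]
  abel

/-- Off `v` the exponent map does not change exponents. -/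
theorem erase_expMap (a : Fin n →₀ ℕ) :
    (a.erase v + single v (weight w a)).erase v = a.erase v := by
  ext j
  by_cases hj : j = v
  · subst hj
    simp only [erase_same]
  · simp [erase_ne hj]

/-- At `v` the exponent map records the total `w`-weight. -/
theorem expMap_apply_self (a : Fin n →₀ ℕ) :
    (a.erase v + single v (weight w a)) v = weight w a := by
  simp only [Finsupp.add_apply, erase_same, single_eq_same, zero_add]

/-- `weight w a = weight w (a.erase v) + a v * w v`. -/
theorem weight_eq_weight_erase_add (a : Fin n →₀ ℕ) :
    weight w a = weight w (a.erase v) + a v * w v := by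
  conv_lhs => rw [← erase_add_single v a]
  rw [map_add, weight_single, smul_eq_mul]

/-- The exponent map is injective when `0 < w v`. -/
theorem expMap_injective (hv : 0 < w v) :
    Function.Injective (fun a : Fin n →₀ ℕ => a.erase v + single v (weight w a)) := by
  intro a b h
  have h1 : a.erase v = b.erase v := by
    have := congrArg (Finsupp.erase v) h
    simpa only [erase_expMap] using this
  have h2 : weight w a = weight w b := by
    have := DFunLike.congr_fun h v
    simpa only [expMap_apply_self] using this
  have ha := weight_eq_weight_erase_add w v a
  have hb := weight_eq_weight_erase_add w v b
  rw [h1, h2, hb] at ha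
  have h3 : a v * w v = b v * w v := (Nat.add_left_cancel ha).symm
  have h4 : a v = b v := Nat.eq_of_mul_eq_mul_right hv h3
  rw [← erase_add_single v a, ← erase_add_single v b, h1, h4]

/-! ### `θ` on monomials -/

/-- `θ (X i) ^ b` is the monomial with exponent `e (single i b)`. -/
theorem theta_X_pow (i : Fin n) (b : ℕ) :
    (if i = v then (X v : MvPolynomial (Fin n) k) ^ (w v) else X i * X v ^ (w i)) ^ b =
      monomial ((single i b).erase v + single v (weight w (single i b))) (1 : k) := by
  rw [weight_single, smul_eq_mul]
  by_cases hi : i = v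
  · subst hi
    rw [if_pos rfl, erase_single, zero_add, ← pow_mul, X_pow_eq_monomial, mul_comm]
  · rw [if_neg hi, erase_single_ne (Ne.symm hi), mul_pow, ← pow_mul, X_pow_eq_monomial,
      X_pow_eq_monomial, monomial_mul, mul_one, mul_comm (w i) b]

/-- **`θ` on monomials**: `θ (monomial a c) = monomial (e a) c`. -/
theorem theta_monomial (a : Fin n →₀ ℕ) (c : k) :
    MvPolynomial.aeval (fun j : Fin n => if j = v then (X v : MvPolynomial (Fin n) k) ^ (w v)
      else X j * X v ^ (w j)) (monomial a c) =
      monomial (a.erase v + single v (weight w a)) c := by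
  induction a using Finsupp.induction with
  | zero =>
    simp only [erase_zero, map_zero, single_zero, add_zero]
    rw [← C_apply, aeval_C, algebraMap_eq]
  | single_add i b f _ _ ih =>
    rw [monomial_single_add, map_mul, map_pow, aeval_X, ih, theta_X_pow, expMap_add, monomial_mul,
      one_mul]

/-- `θ` is the linear extension of the exponent map: `θ = mapDomain e`. -/
theorem theta_eq_mapDomain (U : MvPolynomial (Fin n) k) :
    MvPolynomial.aeval (fun j : Fin n => if j = v then (X v : MvPolynomial (Fin n) k) ^ (w v)
      else X j * X v ^ (w j)) U =
      AddMonoidAlgebra.mapDomain (fun a : Fin n →₀ ℕ => a.erase v + single v (weight w a)) U := by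
  induction U using MvPolynomial.induction_on' with
  | monomial a c =>
    rw [theta_monomial, ← single_eq_monomial, ← single_eq_monomial, AddMonoidAlgebra.mapDomain_single]
  | add p q hp hq => rw [map_add, hp, hq, AddMonoidAlgebra.mapDomain_add]

/-- **`θ` is injective** (for `0 < w v`). -/
theorem theta_injective (hv : 0 < w v) :
    Function.Injective (MvPolynomial.aeval (R := k) (fun j : Fin n => if j = v then
      (X v : MvPolynomial (Fin n) k) ^ (w v) else X j * X v ^ (w j))) := by
  intro U V h
  rw [theta_eq_mapDomain, theta_eq_mapDomain] at h
  exact AddMonoidAlgebra.mapDomain_injective (expMap_injective w v hv) h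

/-! ### Weighted homogeneity of the image -/

/-- `θ (X j)` is `W`-homogeneous of weight `0`. -/
theorem theta_X_isWeightedHomogeneous (j : Fin n) :
    IsWeightedHomogeneous (fun i : Fin n => if i = v then (1 : ZMod (w v)) else -((w i : ℕ) : ZMod (w v)))
      (if j = v then (X v : MvPolynomial (Fin n) k) ^ (w v) else X j * X v ^ (w j)) 0 := by
  by_cases hj : j = v
  · subst hj
    rw [if_pos rfl]
    have h := (isWeightedHomogeneous_X k
      (fun i : Fin n => if i = j then (1 : ZMod (w j)) else -((w i : ℕ) : ZMod (w j))) j).pow (w j)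
    convert h using 1
    simp
  · rw [if_neg hj]
    have h := (isWeightedHomogeneous_X k
      (fun i : Fin n => if i = v then (1 : ZMod (w v)) else -((w i : ℕ) : ZMod (w v))) j).mul
      ((isWeightedHomogeneous_X k
        (fun i : Fin n => if i = v then (1 : ZMod (w v)) else -((w i : ℕ) : ZMod (w v))) v).pow (w j))
    convert h using 1
    simp [if_neg hj]

/-- **Every `θ U` is `W`-homogeneous of weight `0`.** -/
theorem theta_isWeightedHomogeneous (U : MvPolynomial (Fin n) k) :
    IsWeightedHomogeneous (fun i : Fin n => if i = v then (1 : ZMod (w v)) else -((w i : ℕ) : ZMod (w v)))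
      (MvPolynomial.aeval (fun j : Fin n => if j = v then (X v : MvPolynomial (Fin n) k) ^ (w v)
        else X j * X v ^ (w j)) U) 0 := by
  induction U using MvPolynomial.induction_on with
  | C a =>
    rw [aeval_C, algebraMap_eq]
    exact isWeightedHomogeneous_C _ a
  | add p q hp hq =>
    rw [map_add]
    exact hp.add hq
  | mul_X p j hp =>
    rw [map_mul, aeval_X]
    have := hp.mul (theta_X_isWeightedHomogeneous (k := k) w v j)
    rwa [add_zero] at this

/-! ### Weight-`0` polynomials become values of `θ` after a power of `X v` -/

/-- The `W`-weight of an exponent `b` is `b v - Σ_{j ≠ v} w j b j` in `ℤ/(w v)`. -/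
theorem weightW_eq (b : Fin n →₀ ℕ) :
    weight (fun i : Fin n => if i = v then (1 : ZMod (w v)) else -((w i : ℕ) : ZMod (w v))) b =
      (b v : ZMod (w v)) - ((weight w (b.erase v) : ℕ) : ZMod (w v)) := by
  classical
  set W : Fin n → ZMod (w v) := fun i => if i = v then (1 : ZMod (w v)) else -((w i : ℕ) : ZMod (w v))
    with hW
  have hsplit := congrArg (weight W) (erase_add_single v b)
  rw [map_add, weight_single] at hsplit
  rw [← hsplit]
  have hWv : W v = 1 := by simp [hW]
  rw [hWv, nsmul_eq_mul, mul_one]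
  -- the erased part
  have herase : weight W (b.erase v) = -((weight w (b.erase v) : ℕ) : ZMod (w v)) := by
    rw [weight_apply, weight_apply, Finsupp.sum, Finsupp.sum, Nat.cast_sum, ← Finset.sum_neg_distrib]
    refine Finset.sum_congr rfl (fun i hi => ?_)
    have hiv : i ≠ v := by
      intro h
      rw [h, Finsupp.mem_support_iff, erase_same] at hi
      exact hi rfl
    simp only [hW, if_neg hiv, smul_neg, nsmul_eq_mul, smul_eq_mul, Nat.cast_mul]
  rw [herase]
  abel

/-- For a weight-`0` exponent `b` and `M` with `weight w (b.erase v) ≤ w v * M`, the exponent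
`a' = b.erase v + single v ((b v + w v * M - weight w (b.erase v)) / w v)` satisfies
`e a' = b + single v (w v * M)`. -/
theorem expMap_lift (hv : 0 < w v) (b : Fin n →₀ ℕ)
    (hb : weight (fun i : Fin n => if i = v then (1 : ZMod (w v)) else -((w i : ℕ) : ZMod (w v))) b = 0)
    (M : ℕ) (hM : weight w (b.erase v) ≤ w v * M) :
    (b.erase v + single v ((b v + w v * M - weight w (b.erase v)) / w v)).erase v +
        single v (weight w (b.erase v + single v ((b v + w v * M - weight w (b.erase v)) / w v))) =
      b + single v (w v * M) := by
  rw [weightW_eq, sub_eq_zero, ZMod.natCast_eq_natCast_iff'] at hb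
  set S := weight w (b.erase v) with hS
  have hdvd : w v ∣ b v + w v * M - S := by
    apply Nat.dvd_of_mod_eq_zero
    apply Nat.sub_mod_eq_zero_of_mod_eq
    rw [Nat.add_mul_mod_self_left, hb]
  have hq : w v * ((b v + w v * M - S) / w v) = b v + w v * M - S := Nat.mul_div_cancel' hdvd
  have herase : (b.erase v + single v ((b v + w v * M - S) / w v)).erase v = b.erase v := by
    ext j
    by_cases hj : j = v
    · subst hj
      simp only [erase_same]
    · simp [erase_ne hj]
  have hweight : weight w (b.erase v + single v ((b v + w v * M - S) / w v)) = b v + w v * M := by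
    rw [map_add, weight_single, smul_eq_mul, ← hS, mul_comm, hq]
    omega
  rw [herase, hweight, single_add, ← add_assoc, erase_add_single]

/-- **Weight-`0` polynomials lift**: if `U` is `W`-homogeneous of weight `0` then
`X v ^ (w v * M) * U = θ H` for some `M` and `H`. -/
theorem exists_pow_mul_eq_theta (hv : 0 < w v) (U : MvPolynomial (Fin n) k)
    (hU : IsWeightedHomogeneous
      (fun i : Fin n => if i = v then (1 : ZMod (w v)) else -((w i : ℕ) : ZMod (w v))) U 0) :
    ∃ (M : ℕ) (H : MvPolynomial (Fin n) k), X v ^ (w v * M) * U =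
      MvPolynomial.aeval (fun j : Fin n => if j = v then (X v : MvPolynomial (Fin n) k) ^ (w v)
        else X j * X v ^ (w j)) H := by
  classical
  -- a uniform bound `M` with `weight w (b.erase v) ≤ w v * M` for every `b` in the support
  set M : ℕ := ∑ b ∈ U.support, weight w (b.erase v) with hM
  have hMb : ∀ b ∈ U.support, weight w (b.erase v) ≤ w v * M := by
    intro b hb
    have h1 : weight w (b.erase v) ≤ M :=
      Finset.single_le_sum (f := fun b : Fin n →₀ ℕ => weight w (b.erase v)) (fun _ _ => Nat.zero_le _) hb
    calc weight w (b.erase v) ≤ M := h1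
      _ = 1 * M := (one_mul M).symm
      _ ≤ w v * M := Nat.mul_le_mul_right M hv
  refine ⟨M, ∑ b ∈ U.support,
    monomial (b.erase v + single v ((b v + w v * M - weight w (b.erase v)) / w v)) (coeff b U), ?_⟩
  rw [map_sum]
  have hsum : ∀ b ∈ U.support,
      MvPolynomial.aeval (fun j : Fin n => if j = v then (X v : MvPolynomial (Fin n) k) ^ (w v)
        else X j * X v ^ (w j))
        (monomial (b.erase v + single v ((b v + w v * M - weight w (b.erase v)) / w v)) (coeff b U)) =
      monomial b (coeff b U) * X v ^ (w v * M) := by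
    intro b hb
    rw [theta_monomial, expMap_lift w v hv b (hU (MvPolynomial.mem_support_iff.mp hb)) M (hMb b hb),
      monomial_add_single]
  rw [Finset.sum_congr rfl hsum, ← Finset.sum_mul, ← as_sum, mul_comm]

/-! ### The registered stub -/

/-- **`stub_weightedSubstitution`** (registered signature, skeleton 10f06f91 of crux
stmt-ResolutionOfSingularities-15315): for weights `w`, a chart index `v` with `0 < w v`, the
substitution `θ (X v) = X v ^ (w v)`, `θ (X j) = X j * X v ^ (w j)` and the grading `W` of `k[X]` by
`ℤ/(w v)` with `W v = 1`, `W j = -(w j)`: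
`θ` is injective; every `θ U` is `W`-homogeneous of weight `0`; every `W`-weight-`0` polynomial `U`
satisfies `X v ^ (w v * M) * U = θ H` for some `M`, `H`; and the component rule
`(ψ u)_m = ψ · u_{m - δ}` holds for `ψ` homogeneous of weight `δ`. [folklore] -/
theorem stub_weightedSubstitution : ∀ (k : Type) [Field k] (n : ℕ) (w : Fin n → ℕ) (v : Fin n), 0 < w v →
    ∀ (θ : MvPolynomial (Fin n) k →ₐ[k] MvPolynomial (Fin n) k),
    θ = MvPolynomial.aeval (fun j : Fin n => if j = v then (MvPolynomial.X v : MvPolynomial (Fin n) k) ^ (w v)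
      else MvPolynomial.X j * MvPolynomial.X v ^ (w j)) →
    ∀ (W : Fin n → ZMod (w v)), W = (fun j : Fin n => if j = v then (1 : ZMod (w v)) else -((w j : ℕ) : ZMod (w v))) →
    Function.Injective θ ∧
    (∀ U : MvPolynomial (Fin n) k, MvPolynomial.IsWeightedHomogeneous W (θ U) 0) ∧
    (∀ U : MvPolynomial (Fin n) k, MvPolynomial.IsWeightedHomogeneous W U 0 →
      ∃ (M : ℕ) (H : MvPolynomial (Fin n) k), MvPolynomial.X v ^ (w v * M) * U = θ H) ∧
    (∀ (ψ u : MvPolynomial (Fin n) k) (δ m : ZMod (w v)), MvPolynomial.IsWeightedHomogeneous W ψ δ →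
      MvPolynomial.weightedHomogeneousComponent W m (ψ * u) =
        ψ * MvPolynomial.weightedHomogeneousComponent W (m - δ) u) := by
  intro k _ n w v hv θ hθ W hW
  subst hθ hW
  refine ⟨theta_injective w v hv, theta_isWeightedHomogeneous w v, ?_, ?_⟩
  · intro U hU
    exact exists_pow_mul_eq_theta w v hv U hU
  · intro ψ u δ m hψ
    exact weightedHomogeneousComponent_mul_of_isWeightedHomogeneous hψ u m

end Summit.ResolutionOfSingularities.ResolutionOfSingularities.Theorems.FInjectiveMacaulayfication.WeightedSubstitution
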